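import Literature.MathematicalPhysics.QuantumManyBody.PeriodicWeightedFormDomain
import HarnessLib

/-!
# The form domain of `-∑ⱼΔⱼ + W` for an abstract weight: norm dictionary and closability

Topic `Literature/MathematicalPhysics/QuantumManyBody`, sequel of `PeriodicWeightedFormDomain.lean`;
abstract-weight twin of the middle part of `PeriodicFormDomain.lean` (same statements and proofs with
`periodicInteraction v L ↦ W`, under `hWm : Measurable W`, `hW : ∫⁻ X in cellN N L, W X ≠ ⊤`).

* The dictionary: `‖compLpW c‖²`, `‖graphEmbedW Ψ‖² = ∫ |Ψ|² + ∫ (|∇Ψ|² + W|Ψ|²)` (`norm_graphEmbedW_sq`),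
  `= 1 + periodicEnergyW W Ψ` on a trial state (`norm_graphEmbedW_sq_trialState`),
  `‖ι(graphEmbedW Ψ)‖² = ∫ |Ψ|²`, `⟪ι(graphEmbedW Ψ), ι(graphEmbedW Φ)⟫ = ∫ conj(Ψ) Φ`;
* **closability of the form** [ReedSimonI1980, §VIII.6]: `formEmbedW_injective` — the gradient components of
  a limit with vanishing value component vanish by the Fourier relation `configFourierCoeff_fderiv`, the
  potential component `√W ·` value along an a.e.-convergent subsequence.

## References
* [ReedSimonI1980] Reed–Simon I, §VIII.6 (the form of a non-negative operator is closable).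
* [ReedSimonIV1978] Reed–Simon IV, Thm. XIII.64.
-/

noncomputable section

open MeasureTheory Filter Set WithLp Complex UnitAddTorus
open scoped ENNReal NNReal Topology ComplexConjugate InnerProductSpace

namespace Literature.MathematicalPhysics.QuantumManyBody.BoseGas

-- The measure on `ℝ/ℤ` is the Haar PROBABILITY measure, as in `PeriodicFormDomain.lean`.
attribute [local instance] formDomain_measureSpace formDomain_isProbabilityMeasure formDomain_isProbabilityMeasure_pi

variable {N : ℕ} {L : ℝ} {W : Config N → ℝ≥0∞}

/-- Local notation for the Hilbert space `H = L²((ℝ/ℤ)^{3N})`. -/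
local notation "L2T " N':max => Lp ℂ 2 (volume : Measure (UnitAddTorus (Fin N' × Fin 3)))

/-! ### The dictionary: norms and inner products are cell integrals -/


/-- **Component norms are cell integrals**: `‖(graphEmbedW Ψ)_c‖² = ∫_{[0,L)^{3N}} ‖compFunW c‖₊²`.
[folklore] -/
theorem norm_compLpW_sq (hL : 0 < L) (hWm : Measurable W) (hW : ∫⁻ X in cellN N L, W X ≠ ⊤)
    {Ψ : Config N → ℂ} (hΨ : ContDiff ℝ 1 Ψ) (c : CompIdx N) :
    ‖compLpW hL hWm hW hΨ c‖ ^ 2 = (∫⁻ X in cellN N L, ((‖compFunW W Ψ c X‖₊ : ℝ≥0∞)) ^ 2).toReal := by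
  rw [compLpW, norm_smul, mul_pow, Complex.norm_real, Real.norm_of_nonneg (cellScale_nonneg N L),
    cellScale_sq hL.le, norm_toLp_sq_eq_toReal_lintegral, lintegral_torusFunN_compFunW_sq hL hWm hΨ, ENNReal.toReal_mul,
    ← mul_assoc, ENNReal.toReal_pow, ENNReal.toReal_inv, ENNReal.toReal_pow, ENNReal.toReal_ofReal hL.le,
    ← mul_pow, mul_inv_cancel₀ (pow_ne_zero 3 hL.ne'), one_pow, one_mul]

/-- `W < ∞` a.e. on the cell when `W ∈ L¹` of the cell. [folklore] -/
theorem ae_weight_lt_top_cellN (hWm : Measurable W) (hW : ∫⁻ X in cellN N L, W X ≠ ⊤) :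
    ∀ᵐ X ∂(volume.restrict (cellN N L)), W X < ⊤ :=
  ae_lt_top hWm hW

/-- The potential component: `∫_{[0,L)^{3N}} ‖√W Ψ‖₊² = ∫_{[0,L)^{3N}} W‖Ψ‖₊²` (`W < ∞` a.e.). [folklore] -/
theorem lintegral_cellN_sqrt_weight_mul_sq (hWm : Measurable W) (hW : ∫⁻ X in cellN N L, W X ≠ ⊤)
    (Ψ : Config N → ℂ) :
    ∫⁻ X in cellN N L, ((‖((Real.sqrt (W X).toReal : ℝ) : ℂ) * Ψ X‖₊ : ℝ≥0∞)) ^ 2 =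
      ∫⁻ X in cellN N L, W X * ((‖Ψ X‖₊ : ℝ≥0∞)) ^ 2 :=
  lintegral_congr_ae ((ae_weight_lt_top_cellN hWm hW).mono fun _ hX => nnnorm_sqrt_mul_sq_eq hX.ne _)

/-- **The norm of the graph embedding is the energy plus the `L²` norm**:
`‖graphEmbedW Ψ‖² = ∫_{[0,L)^{3N}} ‖Ψ‖₊² + ∫_{[0,L)^{3N}} (|∇Ψ|² + W‖Ψ‖₊²)` (both integrals finite).
[cite: ReedSimonI1980, §VIII.6] -/
theorem norm_graphEmbedW_sq (hL : 0 < L) (hWm : Measurable W) (hW : ∫⁻ X in cellN N L, W X ≠ ⊤)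
    (Ψ : periodicCore N L) :
    ‖graphEmbedW hL hWm hW Ψ‖ ^ 2 =
      (∫⁻ X in cellN N L, ((‖(Ψ : Config N → ℂ) X‖₊ : ℝ≥0∞)) ^ 2).toReal +
      (∫⁻ X in cellN N L, kineticDensity (Ψ : Config N → ℂ) X +
        W X * ((‖(Ψ : Config N → ℂ) X‖₊ : ℝ≥0∞)) ^ 2).toReal := by
  have hΨ : ContDiff ℝ 1 (Ψ : Config N → ℂ) := Ψ.2.1
  rw [PiLp.norm_sq_eq_of_L2]
  simp only [graphEmbedW_apply, norm_compLpW_sq hL hWm hW hΨ]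
  rw [Fintype.sum_sum_type, Fintype.sum_sum_type]
  simp only [Finset.univ_unique, Finset.sum_singleton, compFunW_val, compFunW_grad, compFunW_pot]
  rw [lintegral_cellN_sqrt_weight_mul_sq hWm hW]
  congr 1
  -- the kinetic and potential parts
  have hkin_meas : ∀ p : Fin N × Fin 3, Measurable fun X : Config N =>
      ((‖fderiv ℝ (Ψ : Config N → ℂ) X (Pi.single p.1 (EuclideanSpace.single p.2 1))‖₊ : ℝ≥0∞)) ^ 2 :=
    fun p => (continuous_fderiv_config_single hΨ p.1 p.2).measurable.nnnorm.coe_nnreal_ennreal.pow_const 2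
  have hkin : ∀ X, kineticDensity (Ψ : Config N → ℂ) X = ∑ p : Fin N × Fin 3,
      ((‖fderiv ℝ (Ψ : Config N → ℂ) X (Pi.single p.1 (EuclideanSpace.single p.2 1))‖₊ : ℝ≥0∞)) ^ 2 :=
    fun X => by rw [kineticDensity, Fintype.sum_prod_type]
  have hfin : ∀ p : Fin N × Fin 3, ∫⁻ X in cellN N L,
      ((‖fderiv ℝ (Ψ : Config N → ℂ) X (Pi.single p.1 (EuclideanSpace.single p.2 1))‖₊ : ℝ≥0∞)) ^ 2 ≠ ⊤ :=
    fun p => (lintegral_cellN_sq_lt_top L (continuous_fderiv_config_single hΨ p.1 p.2)).ne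
  rw [← ENNReal.toReal_sum (fun p _ => hfin p),
    ← ENNReal.toReal_add (ENNReal.sum_ne_top.2 fun p _ => hfin p)
      (lintegral_cellN_weight_mul_sq_lt_top hW hΨ.continuous).ne]
  congr 1
  have hpm : Measurable fun X : Config N =>
      W X * ((‖(Ψ : Config N → ℂ) X‖₊ : ℝ≥0∞)) ^ 2 :=
    hWm.mul (hΨ.continuous.measurable.nnnorm.coe_nnreal_ennreal.pow_const 2)
  rw [lintegral_add_right _ hpm]
  congr 1
  simp_rw [hkin]
  rw [lintegral_finsetSum _ fun p _ => hkin_meas p]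

/-- The raw energy of a core function is finite: `∫ |∇Ψ|² + W‖Ψ‖₊² < ∞`. [folklore] -/
theorem lintegral_energyW_lt_top (hWm : Measurable W) (hW : ∫⁻ X in cellN N L, W X ≠ ⊤)
    {Ψ : Config N → ℂ} (hΨ : ContDiff ℝ 1 Ψ) :
    ∫⁻ X in cellN N L, kineticDensity Ψ X + W X * ((‖Ψ X‖₊ : ℝ≥0∞)) ^ 2 < ⊤ := by
  have hpm : Measurable fun X : Config N => W X * ((‖Ψ X‖₊ : ℝ≥0∞)) ^ 2 :=
    hWm.mul (hΨ.continuous.measurable.nnnorm.coe_nnreal_ennreal.pow_const 2)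
  rw [lintegral_add_right _ hpm]
  refine ENNReal.add_lt_top.2 ⟨?_, lintegral_cellN_weight_mul_sq_lt_top hW hΨ.continuous⟩
  have hkin : ∀ X, kineticDensity Ψ X = ∑ p : Fin N × Fin 3,
      ((‖fderiv ℝ Ψ X (Pi.single p.1 (EuclideanSpace.single p.2 1))‖₊ : ℝ≥0∞)) ^ 2 :=
    fun X => by rw [kineticDensity, Fintype.sum_prod_type]
  simp_rw [hkin]
  rw [lintegral_finsetSum _ fun p _ =>
    (continuous_fderiv_config_single hΨ p.1 p.2).measurable.nnnorm.coe_nnreal_ennreal.pow_const 2]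
  exact ENNReal.sum_lt_top.2 fun p _ => lintegral_cellN_sq_lt_top L (continuous_fderiv_config_single hΨ p.1 p.2)

/-- **For a periodic trial state** (normalised on the cell): `‖graphEmbedW Ψ‖² = 1 + periodicEnergyW W Ψ`.
[folklore] -/
theorem norm_graphEmbedW_sq_trialState (hL : 0 < L) (hWm : Measurable W)
    (hW : ∫⁻ X in cellN N L, W X ≠ ⊤) (Ψ : PeriodicTrialState N L) :
    ‖graphEmbedW hL hWm hW ⟨Ψ.ψ, Ψ.mem_periodicCore⟩‖ ^ 2 = 1 + (periodicEnergyW W Ψ).toReal := by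
  rw [norm_graphEmbedW_sq, Ψ.norm_eq, ENNReal.toReal_one]
  rfl

/-- **The embedded norm is the cell norm**: `‖ι(graphEmbedW Ψ)‖² = ∫_{[0,L)^{3N}} ‖Ψ‖₊²`. [folklore] -/
theorem norm_formEmbedW_graphEmbedW_sq (hL : 0 < L) (hWm : Measurable W)
    (hW : ∫⁻ X in cellN N L, W X ≠ ⊤) (Ψ : periodicCore N L) :
    ‖formEmbedW hL hWm hW ⟨graphEmbedW hL hWm hW Ψ, graphEmbedW_mem_formDomainW hL hWm hW Ψ⟩‖ ^ 2 =
      (∫⁻ X in cellN N L, ((‖(Ψ : Config N → ℂ) X‖₊ : ℝ≥0∞)) ^ 2).toReal := by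
  rw [formEmbedW_apply]
  exact norm_compLpW_sq hL hWm hW Ψ.2.1 (Sum.inl ())

/-- For a periodic trial state `‖ι(graphEmbedW Ψ)‖ = 1`. [folklore] -/
theorem norm_formEmbedW_graphEmbedW_trialState (hL : 0 < L) (hWm : Measurable W)
    (hW : ∫⁻ X in cellN N L, W X ≠ ⊤) (Ψ : PeriodicTrialState N L) :
    ‖formEmbedW hL hWm hW ⟨graphEmbedW hL hWm hW ⟨Ψ.ψ, Ψ.mem_periodicCore⟩,
      graphEmbedW_mem_formDomainW hL hWm hW _⟩‖ = 1 := by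
  have h := norm_formEmbedW_graphEmbedW_sq hL hWm hW ⟨Ψ.ψ, Ψ.mem_periodicCore⟩
  rw [show ((⟨Ψ.ψ, Ψ.mem_periodicCore⟩ : periodicCore N L) : Config N → ℂ) = Ψ.ψ from rfl, Ψ.norm_eq,
    ENNReal.toReal_one, pow_eq_one_iff_of_nonneg (norm_nonneg _) two_ne_zero] at h
  exact h

/-- **The embedded inner product is the cell inner product**:
`⟪ι(graphEmbedW Ψ), ι(graphEmbedW Φ)⟫ = ∫_{[0,L)^{3N}} conj(Ψ) Φ`. [folklore] -/
theorem inner_formEmbedW_graphEmbedW (hL : 0 < L) (hWm : Measurable W)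
    (hW : ∫⁻ X in cellN N L, W X ≠ ⊤) (Ψ Φ : periodicCore N L) :
    ⟪formEmbedW hL hWm hW ⟨graphEmbedW hL hWm hW Ψ, graphEmbedW_mem_formDomainW hL hWm hW Ψ⟩,
      formEmbedW hL hWm hW ⟨graphEmbedW hL hWm hW Φ, graphEmbedW_mem_formDomainW hL hWm hW Φ⟩⟫_ℂ =
      ∫ X in cellN N L, conj ((Ψ : Config N → ℂ) X) * (Φ : Config N → ℂ) X := by
  rw [formEmbedW_apply, formEmbedW_apply]
  show ⟪compLpW hL hWm hW Ψ.2.1 (Sum.inl ()), compLpW hL hWm hW Φ.2.1 (Sum.inl ())⟫_ℂ = _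
  rw [compLpW, compLpW, inner_smul_left, inner_smul_right, Complex.conj_ofReal, ← mul_assoc,
    ← Complex.ofReal_mul, ← sq, cellScale_sq hL.le, MeasureTheory.L2.inner_def]
  have hae := ((memLp_torusFunN_compFunW hL hWm hW Ψ.2.1 (Sum.inl ())).coeFn_toLp).and
    ((memLp_torusFunN_compFunW hL hWm hW Φ.2.1 (Sum.inl ())).coeFn_toLp)
  rw [integral_congr_ae (hae.mono fun t ht => by rw [ht.1, ht.2])]
  simp only [compFunW_val, torusFunN, RCLike.inner_apply']
  have hmeas : AEStronglyMeasurable (fun X => conj ((Ψ : Config N → ℂ) X) * (Φ : Config N → ℂ) X)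
      (volume.restrict (cellN N L)) :=
    (Ψ.2.1.continuous.aestronglyMeasurable.star).mul Φ.2.1.continuous.aestronglyMeasurable
  have htr : ∫ t, conj ((Ψ : Config N → ℂ) (fromUnitTorusN L t)) * (Φ : Config N → ℂ) (fromUnitTorusN L t) =
      ((((L ^ 3)⁻¹) ^ N : ℝ)) • ∫ X in cellN N L, conj ((Ψ : Config N → ℂ) X) * (Φ : Config N → ℂ) X :=
    integral_fromUnitTorusN hL (G := fun X => conj ((Ψ : Config N → ℂ) X) * (Φ : Config N → ℂ) X) hmeas
  rw [htr, Complex.real_smul, ← mul_assoc, ← Complex.ofReal_mul, ← mul_pow,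
    mul_inv_cancel₀ (pow_ne_zero 3 hL.ne'), one_pow, Complex.ofReal_one, one_mul]

/-! ### Closability: the embedding `ι` is injective -/

/-- Elements of the form domain are limits of graphs of core functions. [folklore] -/
theorem exists_seq_tendsto_of_mem_formDomainW (hL : 0 < L) (hWm : Measurable W)
    (hW : ∫⁻ X in cellN N L, W X ≠ ⊤) (ξ : formDomainW hL hWm hW) :
    ∃ Ψ : ℕ → periodicCore N L, Tendsto (fun j => graphEmbedW hL hWm hW (Ψ j)) atTop
      (𝓝 (ξ : PiLp 2 (fun _ : CompIdx N => L2T N))) := by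
  have hξ : (ξ : PiLp 2 (fun _ : CompIdx N => L2T N)) ∈
      closure (LinearMap.range (graphEmbedW hL hWm hW) : Set (PiLp 2 (fun _ : CompIdx N => L2T N))) := by
    rw [← Submodule.topologicalClosure_coe]; exact ξ.2
  obtain ⟨x, hx, hlim⟩ := mem_closure_iff_seq_limit.1 hξ
  choose Ψ hΨ using hx
  refine ⟨Ψ, ?_⟩
  have : (fun j => graphEmbedW hL hWm hW (Ψ j)) = x := funext hΨ
  rw [this]
  exact hlim


/-- The Fourier coefficients of the value component: `⟪e_n, (graphEmbedW Ψ)_val⟫ = L^{3N/2} ĉₙ(Ψ)`.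
[folklore] -/
theorem inner_mFourierLp_compLpW_val (hL : 0 < L) (hWm : Measurable W)
    (hW : ∫⁻ X in cellN N L, W X ≠ ⊤) {Ψ : Config N → ℂ} (hΨ : ContDiff ℝ 1 Ψ)
    (n : Fin N × Fin 3 → ℤ) :
    ⟪(mFourierLp 2 n : L2T N), compLpW hL hWm hW hΨ (Sum.inl ())⟫_ℂ =
      (cellScale N L : ℂ) * configFourierCoeff L Ψ n := by
  simp only [compLpW, compFunW_val, inner_smul_right]
  rw [inner_mFourierLp_toLp hL hΨ.continuous]

/-- The Fourier coefficients of a gradient component are `2πi n_{i,k}/L` times those of the value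
component (`configFourierCoeff_fderiv`). [folklore] -/
theorem inner_mFourierLp_compLpW_grad (hL : 0 < L) (hWm : Measurable W)
    (hW : ∫⁻ X in cellN N L, W X ≠ ⊤) {Ψ : Config N → ℂ} (hΨ : ContDiff ℝ 1 Ψ)
    (hper : IsTorusPeriodic L Ψ) (n : Fin N × Fin 3 → ℤ) (p : Fin N × Fin 3) :
    ⟪(mFourierLp 2 n : L2T N), compLpW hL hWm hW hΨ (Sum.inr (Sum.inl p))⟫_ℂ =
      (2 * Real.pi * I * (n p) / L) * ⟪(mFourierLp 2 n : L2T N), compLpW hL hWm hW hΨ (Sum.inl ())⟫_ℂ := by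
  rw [inner_mFourierLp_compLpW_val]
  simp only [compLpW, compFunW_grad, inner_smul_right]
  rw [inner_mFourierLp_toLp hL (continuous_fderiv_config_single hΨ p.1 p.2),
    configFourierCoeff_fderiv hL hΨ hper n p.1 p.2]
  ring

/-- The potential and value components, as functions on the torus: a.e.
`(graphEmbedW Ψ)_pot = √W ∘ fromUnitTorusN · (graphEmbedW Ψ)_val`. [folklore] -/
theorem coeFn_compLpW_pot_ae (hL : 0 < L) (hWm : Measurable W)
    (hW : ∫⁻ X in cellN N L, W X ≠ ⊤) {Ψ : Config N → ℂ} (hΨ : ContDiff ℝ 1 Ψ) :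
    ∀ᵐ t ∂(volume : Measure (UnitAddTorus (Fin N × Fin 3))),
      (compLpW hL hWm hW hΨ (Sum.inr (Sum.inr ())) : UnitAddTorus (Fin N × Fin 3) → ℂ) t =
        ((Real.sqrt (W (fromUnitTorusN L t)).toReal : ℝ) : ℂ) *
          (compLpW hL hWm hW hΨ (Sum.inl ()) : UnitAddTorus (Fin N × Fin 3) → ℂ) t := by
  have h1 := (Lp.coeFn_smul ((cellScale N L : ℝ) : ℂ)
    ((memLp_torusFunN_compFunW hL hWm hW hΨ (Sum.inr (Sum.inr ()))).toLp _)).and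
    (memLp_torusFunN_compFunW hL hWm hW hΨ (Sum.inr (Sum.inr ()))).coeFn_toLp
  have h2 := (Lp.coeFn_smul ((cellScale N L : ℝ) : ℂ)
    ((memLp_torusFunN_compFunW hL hWm hW hΨ (Sum.inl ())).toLp _)).and
    (memLp_torusFunN_compFunW hL hWm hW hΨ (Sum.inl ())).coeFn_toLp
  filter_upwards [h1, h2] with t ht1 ht2
  unfold compLpW
  rw [ht1.1, ht2.1, Pi.smul_apply, Pi.smul_apply, ht1.2, ht2.2]
  simp only [torusFunN, compFunW_pot, compFunW_val, smul_eq_mul]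
  ring

/-- **Closability of the form: the embedding `ι` is injective.** If `graphEmbedW Ψⱼ → ξ` in the
graph space and the value components tend to `0`, then all components of `ξ` vanish: the gradient
components because their Fourier coefficients are `2πi n_{i,k}/L` times those of the value
components, the potential component because it is `√W` times the value component along an
a.e.-convergent subsequence. [cite: ReedSimonI1980, §VIII.6 (the form of a non-negative operator is closable)] -/
theorem formEmbedW_injective (hL : 0 < L) (hWm : Measurable W)
    (hW : ∫⁻ X in cellN N L, W X ≠ ⊤) :
    Function.Injective (formEmbedW hL hWm hW) := by
  refine (injective_iff_map_eq_zero _).2 fun ξ hξ => ?_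
  obtain ⟨Ψ, hΨ⟩ := exists_seq_tendsto_of_mem_formDomainW hL hWm hW ξ
  have hc : ∀ c : CompIdx N, Tendsto (fun j => graphEmbedW hL hWm hW (Ψ j) c) atTop
      (𝓝 ((ξ : PiLp 2 (fun _ : CompIdx N => L2T N)) c)) := fun c =>
    ((PiLp.proj (𝕜 := ℂ) 2 (fun _ : CompIdx N => L2T N) c).continuous.tendsto _).comp hΨ
  have h0 : (ξ : PiLp 2 (fun _ : CompIdx N => L2T N)) (Sum.inl ()) = 0 := hξ
  have hval : Tendsto (fun j => graphEmbedW hL hWm hW (Ψ j) (Sum.inl ())) atTop (𝓝 0) := by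
    rw [← h0]; exact hc _
  apply Subtype.ext
  ext c : 1
  rw [Submodule.coe_zero, PiLp.zero_apply]
  rcases c with u | p | u
  · cases u; exact h0
  · -- gradient components: all Fourier coefficients vanish
    set G := (ξ : PiLp 2 (fun _ : CompIdx N => L2T N)) (Sum.inr (Sum.inl p)) with hG
    have hcoef : ∀ n, ⟪(mFourierLp 2 n : L2T N), G⟫_ℂ = 0 := fun n => by
      have hcont : Continuous fun g : L2T N => ⟪(mFourierLp 2 n : L2T N), g⟫_ℂ :=
        continuous_const.inner continuous_id
      have h1 := (hcont.tendsto G).comp (hc (Sum.inr (Sum.inl p)))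
      have h2 := (hcont.tendsto (0 : L2T N)).comp hval
      rw [inner_zero_right] at h2
      have h3 : (fun g : L2T N => ⟪(mFourierLp 2 n : L2T N), g⟫_ℂ) ∘
          (fun j => graphEmbedW hL hWm hW (Ψ j) (Sum.inr (Sum.inl p))) =
          fun j => (2 * Real.pi * I * (n p) / L) *
            ((fun g : L2T N => ⟪(mFourierLp 2 n : L2T N), g⟫_ℂ) ∘
              (fun j => graphEmbedW hL hWm hW (Ψ j) (Sum.inl ()))) j := by
        funext j
        simp only [Function.comp_apply, graphEmbedW_apply]
        exact inner_mFourierLp_compLpW_grad hL hWm hW (Ψ j).2.1 (Ψ j).2.2.1 n p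
      rw [h3] at h1
      have h4 := h2.const_mul (2 * Real.pi * I * (n p) / L)
      rw [mul_zero] at h4
      exact tendsto_nhds_unique h1 h4
    have hrepr : (mFourierBasis (d := Fin N × Fin 3)).repr G = 0 := by
      ext n
      rw [HilbertBasis.repr_apply_apply, coe_mFourierBasis, hcoef n]
      rfl
    exact (LinearIsometryEquiv.map_eq_zero_iff _).1 hrepr
  · -- the potential component: `√W` times the value component along a.e. subsequences
    cases u
    set M := (ξ : PiLp 2 (fun _ : CompIdx N => L2T N)) (Sum.inr (Sum.inr ())) with hM
    -- an a.e.-convergent subsequence of the value components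
    obtain ⟨ns, hns, hae1⟩ := (tendstoInMeasure_of_tendsto_Lp hval).exists_seq_tendsto_ae
    have hpot : Tendsto (fun j => graphEmbedW hL hWm hW (Ψ (ns j)) (Sum.inr (Sum.inr ()))) atTop (𝓝 M) :=
      (hc (Sum.inr (Sum.inr ()))).comp hns.tendsto_atTop
    obtain ⟨ns', hns', hae2⟩ := (tendstoInMeasure_of_tendsto_Lp hpot).exists_seq_tendsto_ae
    -- the pointwise relation between the two components
    have hrel : ∀ᵐ t ∂(volume : Measure (UnitAddTorus (Fin N × Fin 3))), ∀ j,
        (graphEmbedW hL hWm hW (Ψ j) (Sum.inr (Sum.inr ())) : UnitAddTorus (Fin N × Fin 3) → ℂ) t =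
          ((Real.sqrt (W (fromUnitTorusN L t)).toReal : ℝ) : ℂ) *
            (graphEmbedW hL hWm hW (Ψ j) (Sum.inl ()) : UnitAddTorus (Fin N × Fin 3) → ℂ) t := by
      rw [ae_all_iff]
      intro j
      exact coeFn_compLpW_pot_ae hL hWm hW (Ψ j).2.1
    have hzero := Lp.coeFn_zero (E := ℂ) (p := 2) (μ := (volume : Measure (UnitAddTorus (Fin N × Fin 3))))
    have hMae : (M : UnitAddTorus (Fin N × Fin 3) → ℂ) =ᵐ[volume] 0 := by
      filter_upwards [hae1, hae2, hrel, hzero] with t ht1 ht2 ht3 ht4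
      -- along `ns ∘ ns'`: value → 0, potential → M t, potential = √W · value
      have hWm' : Tendsto (fun j => (graphEmbedW hL hWm hW (Ψ (ns (ns' j))) (Sum.inl ()) :
          UnitAddTorus (Fin N × Fin 3) → ℂ) t) atTop (𝓝 0) := by
        have := ht1.comp hns'.tendsto_atTop
        rw [ht4] at this
        exact this
      have hp' : Tendsto (fun j => (graphEmbedW hL hWm hW (Ψ (ns (ns' j))) (Sum.inr (Sum.inr ())) :
          UnitAddTorus (Fin N × Fin 3) → ℂ) t) atTop (𝓝 (M t)) := ht2
      have hp'' : Tendsto (fun j => (graphEmbedW hL hWm hW (Ψ (ns (ns' j))) (Sum.inr (Sum.inr ())) :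
          UnitAddTorus (Fin N × Fin 3) → ℂ) t) atTop (𝓝 0) := by
        have := hWm'.const_mul ((Real.sqrt (W (fromUnitTorusN L t)).toReal : ℝ) : ℂ)
        rw [mul_zero] at this
        refine this.congr fun j => ?_
        exact (ht3 (ns (ns' j))).symm
      exact tendsto_nhds_unique hp' hp''
    exact Lp.eq_zero_iff_ae_eq_zero.2 hMae
end Literature.MathematicalPhysics.QuantumManyBody.BoseGas

end
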